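import Literature.AlgebraicGeometry.Motives.Jacobian
import HarnessLib

/-!
# The Jacobian (Albanese datum) is transported along an isomorphism of schemes

For the tree's `Jacobian C` of a `k`-scheme `C` (`Motives/Jacobian`: an abelian variety `J` with the difference map
`diff : C × C → J`, `(x, y) ↦ [x − y]`, characterised by the universal property of Milne, *Jacobian Varieties*,
Prop. 6.4 — i.e. `J` is the ALBANESE variety of `C`, Milne Remark 6.5 / Lange Remark 4.5.6) and an isomorphism
`e : C ≅ C'` of `k`-schemes:

* `Jacobian.exists_of_iso` — there is a Jacobian `𝒥'` of `C'` with THE SAME abelian variety, `i : 𝒥'.J ≅ 𝒥.J`, and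
  difference map `diff' = diff ∘ (e⁻¹ × e⁻¹)` (`𝒥'.diff ≫ i = (e.inv ⊗ e.inv) ≫ 𝒥.diff`).  The universal property
  transports: `desc' φ := desc (φ ∘ (e × e))`.  (Milne §1: the Albanese / Jacobian is functorial and «uniquely determined
  up to a unique isomorphism»; an isomorphism of curves induces an isomorphism of Jacobians — the norm map `N_e` of
  Lange §4.5.2 with inverse `N_{e⁻¹}`, cf. the tree's `Jacobian.pushforward`, which however needs a Jacobian of `C'` to
  exist beforehand; this file PRODUCES it.)
* `Jacobian.nonempty_of_iso` — `Nonempty (Jacobian C) → (C ≅ C') → Nonempty (Jacobian C')`.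
* `Jacobian.nonempty_iso_J_of_iso` — any Jacobian `𝒥''` of `C'` has `𝒥''.J ≅ 𝒥.J` (with `uniqueUpToIso`).
* `Jacobian.exists_hom_ne_zero_of_iso` — the REACH form: a non-zero homomorphism `𝒥.J ⟶ B` out of the Albanese variety of
  `C` yields a Jacobian `𝒥'` of `C'` and a non-zero `𝒥'.J ⟶ B`.

All statements are theorems (the transported structure is built inside the proof of `exists_of_iso`; no definition is
added).  USE (cell pub-hodgecm2, TRANSPOSITION item (vi) S2, model match `hReach`): the Albanese datum of a component of
Liu's `Sh(𝕍)_K ⊗_{E,ι₁} ℂ` transports to the tree's isomorphic Picard modular surface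
(`ShimuraVarieties.UnitaryBallModelUnique.exists_iso_of_eq`).

References: J. S. Milne, *Jacobian Varieties* (Ch. VII of Cornell–Silverman 1986), §1 (uniqueness up to unique
isomorphism), §6 Prop. 6.4, Remark 6.5; H. Lange, *Abelian Varieties over the Complex Numbers* (2023), §4.5.2 (the norm
map `N_f`), Prop. 4.5.5, Remark 4.5.6.

## Provenance

Literature file for the Hodge-ladder cell pub-hodgecm2 (COR-CM, stage 2), seat item6-p2 gen 7.  Kernel-checked; no records.
-/

universe u

open CategoryTheory AlgebraicGeometry MonoidalCategory CartesianMonoidalCategory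

noncomputable section

namespace Literature.AlgebraicGeometry.Motives

namespace Jacobian

open scoped MonObj

variable {k : Type u} [Field k] {C C' : SchemeOver k}

/-- **Transport of the Jacobian along an isomorphism of schemes.**  For a Jacobian `𝒥` of `C` and `e : C ≅ C'` there is
a Jacobian `𝒥'` of `C'` with the same abelian variety (`i : 𝒥'.J ≅ 𝒥.J`) and difference map `[x' − y'] := [e⁻¹ x' − e⁻¹ y']`,
i.e. `𝒥'.diff ≫ i = (e.inv ⊗ e.inv) ≫ 𝒥.diff`; its universal property is that of `𝒥` precomposed with `e × e`.
[cite: Milne1986JacobianVarieties, §1 (after Thm. 1.1) and §6 Prop. 6.4, Remark 6.5]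
[cite: Lange2023AbelianVarietiesC, §4.5.2 and Remark 4.5.6] -/
theorem exists_of_iso (𝒥 : Jacobian C) (e : C ≅ C') :
    ∃ (𝒥' : Jacobian C') (i : 𝒥'.J ≅ 𝒥.J), 𝒥'.diff ≫ i.hom.hom.hom.hom = (e.inv ⊗ₘ e.inv) ≫ 𝒥.diff := by
  -- the universal property precomposed with `e × e`
  have hdesc : ∀ {A : AbelianVariety k} (φ : C' ⊗ C' ⟶ A.X), lift (𝟙 C') (𝟙 C') ≫ φ = 1 →
      lift (𝟙 C) (𝟙 C) ≫ ((e.hom ⊗ₘ e.hom) ≫ φ) = 1 := by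
    intro A φ hφ
    rw [← Category.assoc, diag_comp_tensorHom, Category.assoc, hφ, MonObj.comp_one]
  -- `(e⁻¹ ⊗ e⁻¹) ≫ (e ⊗ e) = 𝟙`, `(e ⊗ e) ≫ (e⁻¹ ⊗ e⁻¹) = 𝟙`
  have hie : (e.inv ⊗ₘ e.inv) ≫ (e.hom ⊗ₘ e.hom) = 𝟙 (C' ⊗ C') := by
    rw [tensorHom_comp_tensorHom, e.inv_hom_id, id_tensorHom_id]
  have hei : (e.hom ⊗ₘ e.hom) ≫ (e.inv ⊗ₘ e.inv) = 𝟙 (C ⊗ C) := by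
    rw [tensorHom_comp_tensorHom, e.hom_inv_id, id_tensorHom_id]
  -- the cocycle identity, precomposed with `e⁻¹ ⊗ (e⁻¹ ⊗ e⁻¹)`
  have k1 : (e.inv ⊗ₘ (e.inv ⊗ₘ e.inv)) ≫ lift (fst C (C ⊗ C)) (snd C (C ⊗ C) ≫ fst C C) =
      lift (fst C' (C' ⊗ C')) (snd C' (C' ⊗ C') ≫ fst C' C') ≫ (e.inv ⊗ₘ e.inv) := by
    rw [comp_lift, tensorHom_fst, tensorHom_snd_assoc, tensorHom_fst, lift_map, Category.assoc]
  have k2 : (e.inv ⊗ₘ (e.inv ⊗ₘ e.inv)) ≫ snd C (C ⊗ C) = snd C' (C' ⊗ C') ≫ (e.inv ⊗ₘ e.inv) := by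
    rw [tensorHom_snd]
  have k3 : (e.inv ⊗ₘ (e.inv ⊗ₘ e.inv)) ≫ lift (fst C (C ⊗ C)) (snd C (C ⊗ C) ≫ snd C C) =
      lift (fst C' (C' ⊗ C')) (snd C' (C' ⊗ C') ≫ snd C' C') ≫ (e.inv ⊗ₘ e.inv) := by
    rw [comp_lift, tensorHom_fst, tensorHom_snd_assoc, tensorHom_snd, lift_map, Category.assoc]
  have hcoc : (lift (fst C' (C' ⊗ C')) (snd C' (C' ⊗ C') ≫ fst C' C') ≫ ((e.inv ⊗ₘ e.inv) ≫ 𝒥.diff)) *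
      (snd C' (C' ⊗ C') ≫ ((e.inv ⊗ₘ e.inv) ≫ 𝒥.diff)) =
      lift (fst C' (C' ⊗ C')) (snd C' (C' ⊗ C') ≫ snd C' C') ≫ ((e.inv ⊗ₘ e.inv) ≫ 𝒥.diff) := by
    have h := congrArg (fun g ↦ (e.inv ⊗ₘ (e.inv ⊗ₘ e.inv)) ≫ g) 𝒥.diff_cocycle
    simp only [MonObj.comp_mul, ← Category.assoc] at h
    rw [k1, k2, k3] at h
    simpa only [Category.assoc] using h
  refine ⟨{ J := 𝒥.J
            diff := (e.inv ⊗ₘ e.inv) ≫ 𝒥.diff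
            diff_cocycle := hcoc
            desc := fun φ hφ ↦ 𝒥.desc ((e.hom ⊗ₘ e.hom) ≫ φ) (hdesc φ hφ)
            fac := fun φ hφ ↦ ?_
            uniq := fun φ hφ ψ hψ ↦ ?_ }, Iso.refl _, ?_⟩
  · rw [Category.assoc, 𝒥.fac, ← Category.assoc, hie, Category.id_comp]
  · refine 𝒥.uniq _ (hdesc φ hφ) ψ ?_
    rw [← hψ, ← Category.assoc, ← Category.assoc, hei, Category.id_comp]
  · exact Category.comp_id _

/-- A scheme isomorphic to one with a Jacobian has a Jacobian. [cite: Milne1986JacobianVarieties, §1 and Remark 6.5] -/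
theorem nonempty_of_iso (h : Nonempty (Jacobian C)) (e : C ≅ C') : Nonempty (Jacobian C') :=
  let ⟨𝒥⟩ := h; let ⟨𝒥', _⟩ := 𝒥.exists_of_iso e; ⟨𝒥'⟩

/-- **Isomorphic schemes have isomorphic Albanese varieties**: for `e : C ≅ C'`, any Jacobian `𝒥''` of `C'` has
`𝒥''.J ≅ 𝒥.J` (the transported Jacobian of `exists_of_iso` composed with `uniqueUpToIso`).
[cite: Milne1986JacobianVarieties, §1 and Remark 6.5] [cite: Lange2023AbelianVarietiesC, §4.5.2] -/
theorem nonempty_iso_J_of_iso (𝒥 : Jacobian C) (𝒥'' : Jacobian C') (e : C ≅ C') : Nonempty (𝒥''.J ≅ 𝒥.J) := by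
  obtain ⟨𝒥', i, -⟩ := 𝒥.exists_of_iso e
  exact ⟨(uniqueUpToIso 𝒥'' 𝒥').trans i⟩

/-- **Reach form**: a non-zero homomorphism `w : 𝒥.J ⟶ B` out of the Albanese variety of `C` and an isomorphism
`e : C ≅ C'` give a Jacobian `𝒥'` of `C'` and a non-zero homomorphism `𝒥'.J ⟶ B` (namely `i ≫ w` for the isomorphism
`i : 𝒥'.J ≅ 𝒥.J` of `exists_of_iso`). [cite: Milne1986JacobianVarieties, §1 and Remark 6.5] -/
theorem exists_hom_ne_zero_of_iso (𝒥 : Jacobian C) (e : C ≅ C') {B : AbelianVariety k} {w : 𝒥.J ⟶ B}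
    (hw : w ≠ 0) : ∃ (𝒥' : Jacobian C') (w' : 𝒥'.J ⟶ B), w' ≠ 0 := by
  obtain ⟨𝒥', i, -⟩ := 𝒥.exists_of_iso e
  refine ⟨𝒥', i.hom ≫ w, fun h ↦ hw ?_⟩
  calc w = i.inv ≫ (i.hom ≫ w) := by rw [Iso.inv_hom_id_assoc]
    _ = 0 := by rw [h, Limits.comp_zero]

/-- Reach form for ANY Jacobian of `C'`: with `e : C ≅ C'`, a non-zero `w : 𝒥.J ⟶ B` gives, for every Jacobian `𝒥''`
of `C'`, a non-zero `𝒥''.J ⟶ B`. [cite: Milne1986JacobianVarieties, §1 and Remark 6.5] -/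
theorem exists_hom_ne_zero_of_iso' (𝒥 : Jacobian C) (𝒥'' : Jacobian C') (e : C ≅ C') {B : AbelianVariety k}
    {w : 𝒥.J ⟶ B} (hw : w ≠ 0) : ∃ w' : 𝒥''.J ⟶ B, w' ≠ 0 := by
  obtain ⟨i⟩ := 𝒥.nonempty_iso_J_of_iso 𝒥'' e
  refine ⟨i.hom ≫ w, fun h ↦ hw ?_⟩
  calc w = i.inv ≫ (i.hom ≫ w) := by rw [Iso.inv_hom_id_assoc]
    _ = 0 := by rw [h, Limits.comp_zero]

end Jacobian

end Literature.AlgebraicGeometry.Motives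

end
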